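import Literature.NumberTheory.GaloisRepresentations.HeckeCharacterProofs
import Literature.NumberTheory.GaloisRepresentations.ArtinLFunctionContinuationFE
import Literature.NumberTheory.LFunctions.PartialEulerProductsConvergence
import Mathlib.Analysis.Normed.Module.MultipliableUniformlyOn
import Mathlib.Analysis.Complex.LocallyUniformLimit
import Mathlib.Analysis.SpecialFunctions.Gamma.Deligne
import HarnessLib

/-!
# Hecke `L`-functions on `re s > 1` and the archimedean `Γ`-factor: analytic bricks

Companion to `HeckeCharacter.lean` (statements; Tate (1950) = Cassels–Fröhlich Ch. XV) and
`HeckeCharacterProofs.lean` (`multipliable_heckeLFunction_holds`). Everything in this file is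
PROVED; no named fact (`def … : Prop`) is introduced.

The named fact `heckeLFunction_functional_equation` of `HeckeCharacter.lean` is Tate's Main
Theorem 4.4.1 with §4.5 (Cassels–Fröhlich pp. 340–346: analytic continuation and functional
equation `ζ(f, c) = ζ(f̂, ĉ)` of the global zeta integrals, from the Riemann–Roch theorem 4.2.1 =
adelic Poisson summation and the local functional equations 2.4.1 with the `ρ`-tables of §2.5),
equivalently Neukirch, *Algebraic Number Theory*, VII (8.5)–(8.6)
(`Λ(χ, s) = (|d_K| 𝔑(𝔪))^{s/2} L_∞(χ, s) L(χ, s)`, `Λ(χ, s) = W(χ) Λ(χ̄, 1 - s)`, `|W(χ)| = 1`). None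
of that adelic (or theta-function) analysis exists at this Mathlib pin — Mathlib has `ζ_K` only as
a Dirichlet series on `re s > 1` (`NumberField.dedekindZeta`), and even the continuation of `ζ_K`
is a named fact of the tree (`Literature.NumberTheory.LFunctions.exists_isDedekindZetaContinuation`).
This file supplies the elementary analytic facts about the outer factors of the completed
`L`-function `Λ(χ, s) = A^{s/2} γ_a(s) L(χ, s)` on which any proof, and any use, of that
functional equation rests:

* `HeckeCharacter.isUnitary_inv_iff`, `isUnramifiedAt_inv_iff`, `valueAtUniformizer_inv`,
  `valueAtUniformizer_inv_of_isUnitary`: the dual character `χ⁻¹` (`= χ̄` for unitary `χ`) that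
  appears on the right of the functional equation has the same ramification and conjugate local
  data;
* `norm_eulerFactor_sub_one_le`: `‖(1 - χ(ϖ_v) q_v^{-s})⁻¹ - 1‖ ≤ 2 q_v^{-σ₀}` for `re s ≥ σ₀ ≥ 1`
  (the Weierstrass majorant of Neukirch VII (8.1); the inequality `‖(1 - z)⁻¹ - 1‖ ≤ 2‖z‖` is the
  tree's `Literature.NumberTheory.LFunctions.PartialEuler.norm_inv_one_sub_sub_one_le`);
* `hasProdLocallyUniformlyOn_heckeLFunction`: for unitary `χ` and `σ₀ > 1` the Euler product
  `∏_{v ∤ 𝔣} (1 - χ(ϖ_v) q_v^{-s})⁻¹` converges locally uniformly on `re s > σ₀` to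
  `heckeLFunction χ` (Neukirch VII (8.1): "converges absolutely and uniformly in the domain
  `Re(s) ≥ 1 + δ`, for all `δ > 0`"; Mathlib `Summable.hasProdLocallyUniformlyOn_one_add`);
* `differentiableOn_heckeLFunction`, `analyticAt_heckeLFunction`: `L(χ, s)` is holomorphic on
  `re s > 1` (locally uniform limit of the holomorphic partial products,
  `TendstoLocallyUniformlyOn.differentiableOn`) — Tate, §4.4: "the `ζ`-functions are regular in
  the domain of all quasi-characters of exponent greater than 1";
* `heckeLFunction_ne_zero`: `L(χ, s) ≠ 0` for `re s > 1` (absolutely convergent product of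
  non-zero factors, Mathlib `tprod_one_add_ne_zero_of_summable`);
* `meromorphic_Gammaℝ`, `meromorphic_Gammaℂ`, `meromorphic_archGammaFactor`,
  `archGammaFactor_ne_zero`, `differentiableAt_archGammaFactor`: the `Γ`-factor
  `γ_a(s) = ∏_{w real} Γ_ℝ(s + a_w) ∏_{w complex} Γ_ℂ(s + a_w)` is meromorphic on `ℂ`, and
  holomorphic and non-zero where all `re (s + a_w) > 0` (Mathlib `Complex.differentiable_Gammaℝ_inv`,
  `Complex.Gammaℝ_ne_zero_of_re_pos`; the tree's `Complex.differentiableAt_Gammaℝ_of_ne_zero`,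
  `Complex.differentiableAt_Gammaℂ_of_re_pos`, `Complex.Gammaℂ_ne_zero_of_re_pos` of
  `ArtinLFunctionContinuationFE`);
* `heckeLFunction_functional_equation_iff`: the two-function form of the named fact is
  equivalent to the classical one-function form — one meromorphic `Λ` on `ℂ` with
  `Λ(s) = A^{s/2} γ_a(s) L(χ, s)` and `Λ(1 - s) = W · A^{s/2} γ_{a'}(s) L(χ⁻¹, s)` for `re s > 1`
  (put `Λ'(s) = W⁻¹ Λ(1 - s)`), i.e. exactly the shape of Neukirch VII (8.6).

## References

* J. Tate, *Fourier analysis in number fields and Hecke's zeta-functions* (1950), in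
  Cassels–Fröhlich, *Algebraic Number Theory* (1967), Ch. XV, §4.4 (p. 340, Main Theorem 4.4.1),
  §4.5 (pp. 344–346) [TateThesis1967].
* J. Neukirch, *Algebraic Number Theory*, Grundlehren 322 (1999), VII (8.1) p. 435,
  (8.5)–(8.6) pp. 441–442 [NeukirchANT1999].
-/

noncomputable section

open NumberField IsDedekindDomain Filter Topology

namespace Literature.NumberTheory.GaloisRepresentations

variable {K : Type*} [Field K] [NumberField K]

/-! ### The dual character `χ⁻¹` -/

namespace HeckeCharacter

/-- `χ⁻¹` is unitary iff `χ` is (the `←` direction is the tree's `IsUnitary.inv` of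
`HeckeCharacterNormCharacter.lean`). [folklore] -/
theorem isUnitary_inv_iff {χ : HeckeCharacter K} : χ⁻¹.IsUnitary ↔ χ.IsUnitary := by
  simp only [IsUnitary, inv_apply, Units.val_inv_eq_inv_val, norm_inv, inv_eq_one]

/-- Local components of `χ⁻¹` are the inverses of those of `χ`. [folklore] -/
theorem localComponent_inv_apply (χ : HeckeCharacter K) (v : HeightOneSpectrum (𝓞 K))
    (u : (v.adicCompletion K)ˣ) : χ⁻¹.localComponent v u = (χ.localComponent v u)⁻¹ :=
  rfl

/-- `χ⁻¹` is unramified at `v` iff `χ` is (so `L(χ⁻¹, s)` runs over the same places as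
`L(χ, s)`).  Ref: Neukirch, *Algebraic Number Theory*, VII §6, (6.10)–(6.11). [folklore] -/
theorem isUnramifiedAt_inv_iff {χ : HeckeCharacter K} {v : HeightOneSpectrum (𝓞 K)} :
    χ⁻¹.IsUnramifiedAt v ↔ χ.IsUnramifiedAt v := by
  simp only [IsUnramifiedAt, localComponent_inv_apply, inv_eq_one]

/-- `χ⁻¹(ϖ_v) = χ(ϖ_v)⁻¹`. [folklore] -/
theorem valueAtUniformizer_inv (χ : HeckeCharacter K) (v : HeightOneSpectrum (𝓞 K)) :
    χ⁻¹.valueAtUniformizer v = (χ.valueAtUniformizer v)⁻¹ := by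
  simp only [valueAtUniformizer, localComponent_inv_apply, Units.val_inv_eq_inv_val]

/-- For unitary `χ`, `χ⁻¹(ϖ_v) = conj χ(ϖ_v)`: the dual character is the complex conjugate
character `χ̄` of Neukirch VII (8.5)–(8.6) and Tate §4.5. [folklore] -/
theorem valueAtUniformizer_inv_of_isUnitary {χ : HeckeCharacter K} (hχ : χ.IsUnitary)
    (v : HeightOneSpectrum (𝓞 K)) :
    χ⁻¹.valueAtUniformizer v = starRingEnd ℂ (χ.valueAtUniformizer v) := by
  rw [valueAtUniformizer_inv, Complex.inv_eq_conj (norm_valueAtUniformizer_of_isUnitary hχ v)]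

end HeckeCharacter

/-! ### The local Euler factors on `re s > 0` -/

/-- For unitary `χ` and `re s > 0` the Euler factor denominator `1 - χ(ϖ_v) q_v^{-s}` does not
vanish (`‖χ(ϖ_v) q_v^{-s}‖ = q_v^{-re s} < 1`). [folklore] -/
theorem one_sub_valueAtUniformizer_mul_cpow_ne_zero {χ : HeckeCharacter K} (hχ : χ.IsUnitary)
    (v : HeightOneSpectrum (𝓞 K)) {s : ℂ} (hs : 0 < s.re) :
    1 - χ.valueAtUniformizer v * ((v.residueCard : ℂ) ^ (-s)) ≠ 0 := by
  intro h
  have h1 : ‖χ.valueAtUniformizer v * ((v.residueCard : ℂ) ^ (-s))‖ = 1 := by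
    rw [sub_eq_zero] at h
    rw [← h, norm_one]
  rw [HeckeCharacter.norm_valueAtUniformizer_mul_cpow hχ] at h1
  have hq1 : (1 : ℝ) < v.residueCard := by exact_mod_cast v.one_lt_residueCard
  have : (v.residueCard : ℝ) ^ (-s.re) < 1 :=
    Real.rpow_lt_one_of_one_lt_of_neg hq1 (by linarith)
  linarith

/-- The Euler factor `s ↦ (1 - χ(ϖ_v) q_v^{-s})⁻¹` of a unitary `χ` is holomorphic on `re s > 0`.
[folklore] -/
theorem differentiableAt_eulerFactor {χ : HeckeCharacter K} (hχ : χ.IsUnitary)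
    (v : HeightOneSpectrum (𝓞 K)) {s : ℂ} (hs : 0 < s.re) :
    DifferentiableAt ℂ
      (fun s : ℂ => (1 - χ.valueAtUniformizer v * ((v.residueCard : ℂ) ^ (-s)))⁻¹) s := by
  have hq : (v.residueCard : ℂ) ≠ 0 :=
    Nat.cast_ne_zero.mpr (Nat.pos_of_ne_zero (by
      intro h0; have := v.one_lt_residueCard; omega)).ne'
  have hpow : DifferentiableAt ℂ (fun s : ℂ => (v.residueCard : ℂ) ^ (-s)) s :=
    differentiableAt_id.neg.const_cpow (Or.inl hq)
  exact ((differentiableAt_const _).sub ((differentiableAt_const _).mul hpow)).inv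
    (one_sub_valueAtUniformizer_mul_cpow_ne_zero hχ v hs)

/-- **The Weierstrass majorant** (Neukirch VII (8.1), proof): for unitary `χ`, `1 ≤ σ₀ ≤ re s`,
`‖(1 - χ(ϖ_v) q_v^{-s})⁻¹ - 1‖ ≤ 2 q_v^{-σ₀}` (`‖χ(ϖ_v) q_v^{-s}‖ = q_v^{-re s} ≤ q_v^{-σ₀} ≤ 1/2`
as `q_v ≥ 2`). [cite: NeukirchANT1999, Ch. VII Prop. (8.1)] -/
theorem norm_eulerFactor_sub_one_le {χ : HeckeCharacter K} (hχ : χ.IsUnitary)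
    (v : HeightOneSpectrum (𝓞 K)) {σ₀ : ℝ} (hσ₀ : 1 ≤ σ₀) {s : ℂ} (hs : σ₀ ≤ s.re) :
    ‖(1 - χ.valueAtUniformizer v * ((v.residueCard : ℂ) ^ (-s)))⁻¹ - 1‖ ≤
      2 * (v.residueCard : ℝ) ^ (-σ₀) := by
  have hq1 : (1 : ℝ) < v.residueCard := by exact_mod_cast v.one_lt_residueCard
  have hq2 : (2 : ℝ) ≤ v.residueCard := by exact_mod_cast Nat.succ_le_of_lt v.one_lt_residueCard
  have hx : ‖χ.valueAtUniformizer v * ((v.residueCard : ℂ) ^ (-s))‖ ≤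
      (v.residueCard : ℝ) ^ (-σ₀) := by
    rw [HeckeCharacter.norm_valueAtUniformizer_mul_cpow hχ]
    exact Real.rpow_le_rpow_of_exponent_le hq1.le (neg_le_neg hs)
  have hhalf : (v.residueCard : ℝ) ^ (-σ₀) ≤ 1 / 2 :=
    calc (v.residueCard : ℝ) ^ (-σ₀) ≤ (v.residueCard : ℝ) ^ (-1 : ℝ) :=
          Real.rpow_le_rpow_of_exponent_le hq1.le (neg_le_neg hσ₀)
      _ = (v.residueCard : ℝ)⁻¹ := Real.rpow_neg_one _
      _ ≤ 2⁻¹ := inv_anti₀ two_pos hq2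
      _ = 1 / 2 := by norm_num
  calc ‖(1 - χ.valueAtUniformizer v * ((v.residueCard : ℂ) ^ (-s)))⁻¹ - 1‖
        ≤ 2 * ‖χ.valueAtUniformizer v * ((v.residueCard : ℂ) ^ (-s))‖ :=
          LFunctions.PartialEuler.norm_inv_one_sub_sub_one_le (hx.trans hhalf)
    _ ≤ 2 * (v.residueCard : ℝ) ^ (-σ₀) := by gcongr

/-- The majorant is summable over the unramified places: `∑_v 2 q_v^{-σ₀} < ∞` for `σ₀ > 1`
(tree: `Literature.NumberTheory.Automorphic.summable_residueCard_rpow_neg`, convergence of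
`ζ_K(σ₀)`). [folklore] -/
theorem summable_majorant_heckeLFunction (χ : HeckeCharacter K) {σ₀ : ℝ} (hσ₀ : 1 < σ₀) :
    Summable fun v : {v : HeightOneSpectrum (𝓞 K) // χ.IsUnramifiedAt v} =>
      2 * (v.1.residueCard : ℝ) ^ (-σ₀) := by
  refine Summable.mul_left 2 ?_
  exact (Automorphic.summable_residueCard_rpow_neg hσ₀).comp_injective Subtype.val_injective

/-! ### Locally uniform convergence, holomorphy and non-vanishing on `re s > 1` -/

/-- **Locally uniform convergence of the Euler product** (Neukirch VII (8.1): the product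
"converges absolutely and uniformly in the domain `Re(s) ≥ 1 + δ`, for all `δ > 0`"): for a
unitary Hecke character `χ` and `σ₀ > 1`, the Euler product `∏_{v ∤ 𝔣(χ)} (1 - χ(ϖ_v) q_v^{-s})⁻¹`
converges locally uniformly on `re s > σ₀` to `heckeLFunction χ` (Weierstrass `M`-test,
`norm_eulerFactor_sub_one_le`, `summable_majorant_heckeLFunction`; Mathlib
`Summable.hasProdLocallyUniformlyOn_one_add`). [cite: NeukirchANT1999, Ch. VII Prop. (8.1)] -/
theorem hasProdLocallyUniformlyOn_heckeLFunction {χ : HeckeCharacter K} (hχ : χ.IsUnitary)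
    {σ₀ : ℝ} (hσ₀ : 1 < σ₀) :
    HasProdLocallyUniformlyOn
      (fun (v : {v : HeightOneSpectrum (𝓞 K) // χ.IsUnramifiedAt v}) (s : ℂ) =>
        (1 - χ.valueAtUniformizer v.1 * ((v.1.residueCard : ℂ) ^ (-s)))⁻¹)
      (heckeLFunction χ) {s : ℂ | σ₀ < s.re} := by
  have hopen : IsOpen {s : ℂ | σ₀ < s.re} := isOpen_lt continuous_const Complex.continuous_re
  have h := Summable.hasProdLocallyUniformlyOn_one_add (K := {s : ℂ | σ₀ < s.re})
    (f := fun (v : {v : HeightOneSpectrum (𝓞 K) // χ.IsUnramifiedAt v}) (s : ℂ) =>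
      (1 - χ.valueAtUniformizer v.1 * ((v.1.residueCard : ℂ) ^ (-s)))⁻¹ - 1)
    hopen (summable_majorant_heckeLFunction χ hσ₀)
    (Filter.Eventually.of_forall fun v s hs =>
      norm_eulerFactor_sub_one_le hχ v.1 hσ₀.le (le_of_lt hs))
    (fun v s hs => ((differentiableAt_eulerFactor hχ v.1
      (lt_trans (by linarith) (show σ₀ < s.re from hs))).sub_const 1).continuousAt.continuousWithinAt)
  rw [show heckeLFunction χ = fun s : ℂ =>
      ∏' v : {v : HeightOneSpectrum (𝓞 K) // χ.IsUnramifiedAt v},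
        (1 - χ.valueAtUniformizer v.1 * ((v.1.residueCard : ℂ) ^ (-s)))⁻¹ from rfl]
  simpa only [add_sub_cancel] using h

/-- The partial Euler products over finite sets of unramified places converge locally uniformly
on `re s > σ₀`, `σ₀ > 1`, to `heckeLFunction χ` (the same statement along `atTop`). [folklore] -/
theorem tendstoLocallyUniformlyOn_heckeLFunction {χ : HeckeCharacter K} (hχ : χ.IsUnitary)
    {σ₀ : ℝ} (hσ₀ : 1 < σ₀) :
    TendstoLocallyUniformlyOn
      (fun (S : Finset {v : HeightOneSpectrum (𝓞 K) // χ.IsUnramifiedAt v}) (s : ℂ) =>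
        ∏ v ∈ S, (1 - χ.valueAtUniformizer v.1 * ((v.1.residueCard : ℂ) ^ (-s)))⁻¹)
      (heckeLFunction χ) atTop {s : ℂ | σ₀ < s.re} :=
  hasProdLocallyUniformlyOn_iff_tendstoLocallyUniformlyOn.mp
    (hasProdLocallyUniformlyOn_heckeLFunction hχ hσ₀)

/-- `heckeLFunction χ` is holomorphic on `re s > σ₀` for every `σ₀ > 1` (locally uniform limit of
the holomorphic partial products; Mathlib `TendstoLocallyUniformlyOn.differentiableOn`).
[folklore] -/
theorem differentiableOn_heckeLFunction_of_lt {χ : HeckeCharacter K} (hχ : χ.IsUnitary)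
    {σ₀ : ℝ} (hσ₀ : 1 < σ₀) :
    DifferentiableOn ℂ (heckeLFunction χ) {s : ℂ | σ₀ < s.re} := by
  refine (tendstoLocallyUniformlyOn_heckeLFunction hχ hσ₀).differentiableOn
    (Filter.Eventually.of_forall fun S => ?_) (isOpen_lt continuous_const Complex.continuous_re)
  refine DifferentiableOn.fun_finsetProd fun v _ => fun s hs => ?_
  exact (differentiableAt_eulerFactor hχ v.1
    (lt_trans (by linarith) (show σ₀ < s.re from hs))).differentiableWithinAt

/-- **Holomorphy of `L(χ, s)` on `re s > 1`** for a unitary Hecke character `χ` (Tate, §4.4: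
"the `ζ`-functions are regular in the domain of all quasi-characters of exponent greater than 1";
Neukirch VII (8.1)). [cite: NeukirchANT1999, Ch. VII Prop. (8.1)] -/
theorem differentiableOn_heckeLFunction {χ : HeckeCharacter K} (hχ : χ.IsUnitary) :
    DifferentiableOn ℂ (heckeLFunction χ) {s : ℂ | 1 < s.re} := by
  intro s hs
  have hs' : 1 < s.re := hs
  have hσ : 1 < (1 + s.re) / 2 := by linarith
  have hmem : s ∈ {z : ℂ | (1 + s.re) / 2 < z.re} := by
    show (1 + s.re) / 2 < s.re
    linarith
  exact ((differentiableOn_heckeLFunction_of_lt hχ hσ).differentiableAt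
    ((isOpen_lt continuous_const Complex.continuous_re).mem_nhds hmem)).differentiableWithinAt

/-- `heckeLFunction χ` is analytic at every `s` with `re s > 1`. [folklore] -/
theorem analyticAt_heckeLFunction {χ : HeckeCharacter K} (hχ : χ.IsUnitary) {s : ℂ}
    (hs : 1 < s.re) : AnalyticAt ℂ (heckeLFunction χ) s :=
  (differentiableOn_heckeLFunction hχ).analyticAt
    ((isOpen_lt continuous_const Complex.continuous_re).mem_nhds hs)

/-- **Non-vanishing of `L(χ, s)` on `re s > 1`**: an absolutely convergent product of non-zero
factors is non-zero (Mathlib `tprod_one_add_ne_zero_of_summable`).  Ref: Neukirch VII (8.1)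
(proof: `E(s) = exp(∑_𝔭 ∑_n χ(𝔭)ⁿ / (n 𝔑(𝔭)^{ns}))`). [cite: NeukirchANT1999, Ch. VII Prop. (8.1)] -/
theorem heckeLFunction_ne_zero {χ : HeckeCharacter K} (hχ : χ.IsUnitary) {s : ℂ}
    (hs : 1 < s.re) : heckeLFunction χ s ≠ 0 := by
  have hsum : Summable fun v : {v : HeightOneSpectrum (𝓞 K) // χ.IsUnramifiedAt v} =>
      ‖(1 - χ.valueAtUniformizer v.1 * ((v.1.residueCard : ℂ) ^ (-s)))⁻¹ - 1‖ :=
    Summable.of_nonneg_of_le (fun _ => norm_nonneg _)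
      (fun v => norm_eulerFactor_sub_one_le hχ v.1 hs.le le_rfl)
      (summable_majorant_heckeLFunction χ hs)
  have hne : ∀ v : {v : HeightOneSpectrum (𝓞 K) // χ.IsUnramifiedAt v},
      1 + ((1 - χ.valueAtUniformizer v.1 * ((v.1.residueCard : ℂ) ^ (-s)))⁻¹ - 1) ≠ 0 := by
    intro v
    rw [add_sub_cancel]
    exact inv_ne_zero (one_sub_valueAtUniformizer_mul_cpow_ne_zero hχ v.1 (by linarith))
  have := tprod_one_add_ne_zero_of_summable hne hsum
  simp only [add_sub_cancel] at this
  exact this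

/-! ### The archimedean `Γ`-factor -/

/-- `Γ_ℝ(s) = π^{-s/2} Γ(s/2)` is meromorphic on `ℂ` (its inverse is entire, Mathlib
`Complex.differentiable_Gammaℝ_inv`). [folklore] -/
theorem meromorphic_Gammaℝ : Meromorphic Complex.Gammaℝ := by
  have h : Meromorphic fun s : ℂ => (Complex.Gammaℝ s)⁻¹ := fun x =>
    (Complex.differentiable_Gammaℝ_inv.analyticAt x).meromorphicAt
  have e : Complex.Gammaℝ = (fun s : ℂ => (Complex.Gammaℝ s)⁻¹)⁻¹ := by
    funext s
    simp
  rw [e]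
  exact h.inv

/-- `Γ_ℂ(s) = Γ_ℝ(s) Γ_ℝ(s + 1)` is meromorphic on `ℂ`. [folklore] -/
theorem meromorphic_Gammaℂ : Meromorphic Complex.Gammaℂ := by
  have e : Complex.Gammaℂ = fun s : ℂ => Complex.Gammaℝ s * Complex.Gammaℝ (s + 1) :=
    funext fun s => (Complex.Gammaℝ_mul_Gammaℝ_add_one s).symm
  rw [e]
  intro x
  exact (meromorphic_Gammaℝ x).fun_mul
    ((meromorphic_Gammaℝ (x + 1)).comp_analyticAt (g := fun s : ℂ => s + 1) (by fun_prop))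

/-- **The archimedean `Γ`-factor is meromorphic on `ℂ`** for every choice of shifts `a`
(finite product of `Γ_ℝ(s + a_w)`, `Γ_ℂ(s + a_w)`).  Ref: Tate (1950), §2.5; Neukirch VII (8.3).
[folklore] -/
theorem meromorphic_archGammaFactor (a : InfinitePlace K → ℂ) :
    Meromorphic (HeckeCharacter.archGammaFactor a) := by
  intro x
  unfold HeckeCharacter.archGammaFactor
  refine MeromorphicAt.fun_prod fun w _ => ?_
  by_cases hw : w.IsReal
  · simp only [hw, if_true]
    exact (meromorphic_Gammaℝ (x + a w)).comp_analyticAt (g := fun s : ℂ => s + a w)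
      (by fun_prop)
  · simp only [hw, if_false]
    exact (meromorphic_Gammaℂ (x + a w)).comp_analyticAt (g := fun s : ℂ => s + a w)
      (by fun_prop)

/-- The `Γ`-factor does not vanish where all `re (s + a_w) > 0`. [folklore] -/
theorem archGammaFactor_ne_zero (a : InfinitePlace K → ℂ) {s : ℂ}
    (hs : ∀ w : InfinitePlace K, 0 < (s + a w).re) :
    HeckeCharacter.archGammaFactor a s ≠ 0 := by
  unfold HeckeCharacter.archGammaFactor
  refine Finset.prod_ne_zero_iff.mpr fun w _ => ?_
  split_ifs with hw
  · exact Complex.Gammaℝ_ne_zero_of_re_pos (hs w)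
  · exact Complex.Gammaℂ_ne_zero_of_re_pos (hs w)

/-- The `Γ`-factor is holomorphic where all `re (s + a_w) > 0`. [folklore] -/
theorem differentiableAt_archGammaFactor (a : InfinitePlace K → ℂ) {s : ℂ}
    (hs : ∀ w : InfinitePlace K, 0 < (s + a w).re) :
    DifferentiableAt ℂ (HeckeCharacter.archGammaFactor a) s := by
  unfold HeckeCharacter.archGammaFactor
  refine DifferentiableAt.fun_finsetProd fun w _ => ?_
  by_cases hw : w.IsReal
  · simp only [hw, if_true]
    exact (Complex.differentiableAt_Gammaℝ_of_ne_zero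
      (Complex.Gammaℝ_ne_zero_of_re_pos (hs w))).comp s
        (differentiableAt_id.add (differentiableAt_const _))
  · simp only [hw, if_false]
    exact (Complex.differentiableAt_Gammaℂ_of_re_pos (hs w)).comp s
      (differentiableAt_id.add (differentiableAt_const _))

/-! ### The one-function form of the functional equation -/

/-- **The named fact in classical form.**  `heckeLFunction_functional_equation χ` (two
meromorphic functions `Λ, Λ'` continuing the completed `L`-functions of `χ` and `χ⁻¹` with
`Λ(1 - s) = W Λ'(s)`) is equivalent to the statement in the shape of Neukirch VII (8.6)
"`Λ(χ, s)` admits a meromorphic continuation and `Λ(χ, s) = W(χ) Λ(χ̄, 1 - s)`": a single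
meromorphic `Λ` on `ℂ` with `Λ(s) = A^{s/2} γ_a(s) L(χ, s)` and
`Λ(1 - s) = W · A^{s/2} γ_{a'}(s) L(χ⁻¹, s)` for `re s > 1`.  (`⇐`: put `Λ'(s) = W⁻¹ Λ(1 - s)`,
meromorphic as the composite of `Λ` with `s ↦ 1 - s`.) [cite: NeukirchANT1999, VII (8.6)] -/
theorem heckeLFunction_functional_equation_iff (χ : HeckeCharacter K) :
    heckeLFunction_functional_equation χ ↔
      ∀ (_hχ : χ.IsUnitary),
        ∃ (A : ℝ) (a a' : InfinitePlace K → ℂ) (W : ℂ) (Λ : ℂ → ℂ), 0 < A ∧ ‖W‖ = 1 ∧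
          Meromorphic Λ ∧
          (∀ s : ℂ, 1 < s.re →
            Λ s = (A : ℂ) ^ (s / 2) * HeckeCharacter.archGammaFactor a s * heckeLFunction χ s) ∧
          ∀ s : ℂ, 1 < s.re →
            Λ (1 - s) = W * ((A : ℂ) ^ (s / 2) * HeckeCharacter.archGammaFactor a' s *
              heckeLFunction χ⁻¹ s) := by
  constructor
  · intro h hχ
    obtain ⟨A, a, a', W, Λ, Λ', hA, hW, hΛ, -, hagree, hFE⟩ := h hχ
    exact ⟨A, a, a', W, Λ, hA, hW, hΛ, fun s hs => (hagree s hs).1,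
      fun s hs => by rw [hFE s, (hagree s hs).2]⟩
  · intro h hχ
    obtain ⟨A, a, a', W, Λ, hA, hW, hΛ, h1, h2⟩ := h hχ
    have hW0 : W ≠ 0 := norm_ne_zero_iff.mp (by rw [hW]; exact one_ne_zero)
    refine ⟨A, a, a', W, Λ, fun s => W⁻¹ * Λ (1 - s), hA, hW, hΛ, fun x => ?_,
      fun s hs => ⟨h1 s hs, ?_⟩, fun s => ?_⟩
    · have hc : MeromorphicAt (Λ ∘ fun s : ℂ => 1 - s) x :=
        (hΛ (1 - x)).comp_analyticAt (analyticAt_const.sub analyticAt_id)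
      exact (MeromorphicAt.const W⁻¹ x).fun_mul hc
    · show W⁻¹ * Λ (1 - s) = _
      rw [h2 s hs, ← mul_assoc, inv_mul_cancel₀ hW0, one_mul]
    · show Λ (1 - s) = W * (W⁻¹ * Λ (1 - s))
      rw [← mul_assoc, mul_inv_cancel₀ hW0, one_mul]

end Literature.NumberTheory.GaloisRepresentations
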